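import Literature.NumberTheory.ComplexMultiplication.EllipticUnits.ImaginaryQuadraticMainConjectureCarriers
import Literature.NumberTheory.GaloisRepresentations.KummerSES
import HarnessLib

/-!
# M-LINE-PIN / (α3) ROW 2, FILE 3b: the level groups `H¹(G_S(F), μ_{p^k} ⊗ θ)` are killed by `p^k`

Cell `bsd-print-cf2`, WIDTH seat `bsd-line-cf2-p1-w6` g8 (prover-bsd-line-cf2-p1-w6-g8-0); (α3) ROW 2 on the DECIDING child stmt-BirchSwinnertonDyer-24721
(memo `HOME/bsd-line-cf2-p1-w6/ROW2-SPEC-w6g8.md`, hypothesis `htors` of `RowTwo.exists_lift`); `--supports` that item (helper, Theses-free).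
HONEST FRAMING: one-line cohomological bookkeeping; nothing about BSD. THEOREMS ONLY.

* `zsmul_levelCoh_one_eq_zero` — `(p^k) • x = 0` for every `x ∈ levelCoh p S θ U k 1 = H¹(U_S, (μ_{p^k} ⊗ θ)^{N_S})` (the coefficients are killed
  by `p^k`; a class is the class of a cocycle); `nsmul_levelCoh_one_eq_zero`, `exists_pow_smul_levelCoh_one_eq_zero` (the `htors` shape).

References: J.-P. Serre, *Galois Cohomology* (1997) I §2.2; Johnson-Leung–Kings (2011) Def. 4.2.
-/

noncomputable section

-- the summit namespace `Summit.BirchSwinnertonDyer.BirchSwinnertonDyer` repeats the problem name by design (D-0017)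
set_option linter.dupNamespace false
set_option autoImplicit false

open scoped NumberField
open Field IsDedekindDomain
open Literature.NumberTheory.GaloisRepresentations Literature.NumberTheory.GaloisRepresentations.DiscreteGaloisModule
open Literature.NumberTheory.ComplexMultiplication.EllipticUnits.JohnsonLeungKings2011

namespace Summit.BirchSwinnertonDyer.BirchSwinnertonDyer.Theorems.PrintCf2.RowTwo

variable {K : Type} [Field K] [NumberField K] (p : ℕ) [Fact p.Prime] (S : Set (HeightOneSpectrum (𝓞 K)))
  (θ : absoluteGaloisGroup K →ₜ* ℤ_[p]ˣ) (U : Subgroup (absoluteGaloisGroup K)) (k : ℕ)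

omit [NumberField K] in
/-- **`p^k` kills `H¹(G_S(F), μ_{p^k} ⊗ θ)`** (integer scalar, on cocycles). [cite: SerreGaloisCohomology1997, I §2.2] -/
theorem zsmul_contOneCocycles_levelRep_eq_zero (φ : contOneCocycles (levelRep p S θ U k).toTopRep) : ((p ^ k : ℕ) : ℤ) • φ = 0 := by
  refine Subtype.ext (ContinuousMap.ext fun g ↦ ?_)
  change ((p ^ k : ℕ) : ℤ) • φ.1 g = 0
  exact Subtype.ext (zsmul_muCarrier_eq_zero K (p ^ k) _)

omit [NumberField K] in
/-- **`p^k` kills `H¹(G_S(F), μ_{p^k} ⊗ θ)`.** [cite: SerreGaloisCohomology1997, I §2.2] -/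
theorem zsmul_levelCoh_one_eq_zero (x : levelCoh p S θ U k 1) : ((p ^ k : ℕ) : ℤ) • x = 0 := by
  obtain ⟨φ, rfl⟩ := oneCocycleClass_surjective _ x
  rw [← oneCocycleClassₗ_apply, ← map_zsmul (oneCocycleClassₗ (levelRep p S θ U k).toTopRep) ((p ^ k : ℕ) : ℤ) φ,
    zsmul_contOneCocycles_levelRep_eq_zero, map_zero]

omit [NumberField K] in
/-- `p^k • x = 0` (natural-number scalar). [cite: SerreGaloisCohomology1997, I §2.2] -/
theorem nsmul_levelCoh_one_eq_zero (x : levelCoh p S θ U k 1) : (p ^ k) • x = 0 := by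
  rw [← natCast_zsmul]
  exact zsmul_levelCoh_one_eq_zero p S θ U k x

omit [NumberField K] in
/-- The `htors` shape of `RowTwo.exists_lift`: every class is killed by SOME power of `p`. [cite: SerreGaloisCohomology1997, I §2.2] -/
theorem exists_pow_smul_levelCoh_one_eq_zero (x : levelCoh p S θ U k 1) : ∃ e : ℕ, p ^ e • x = 0 :=
  ⟨k, nsmul_levelCoh_one_eq_zero p S θ U k x⟩

end Summit.BirchSwinnertonDyer.BirchSwinnertonDyer.Theorems.PrintCf2.RowTwo

end
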